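import Mathlib
import Literature.Analysis.FunctionSpaces.TorusSymbolCalculus
import Literature.Analysis.FunctionSpaces.TorusFourierCalculus
import Literature.Analysis.FunctionSpaces.TorusCalculusProofs
import Literature.Analysis.FunctionSpaces.TorusSobolevNorm
import Literature.Analysis.FunctionSpaces.TorusFourierConvolution
import Summits.NavierStokesRegularity.FluidComputer.ConvectiveProductLawLattice
import HarnessLib

/-!
# The convective product law `H² · H² → H¹` on the unit torus: `‖(v·∇)w‖_{H¹} ≤ 4πσ ‖v‖_{H²} ‖w‖_{H²}` (instab g12, cell `ns-blowup`, 2026-08-26)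

HONEST FRAMING (human ruling D-0035): nothing here is a claim about Navier–Stokes blow-up.
WHAT THIS IS NOT: not NS evidence — the torus-side dictionary for the lattice product law
`ConvectiveProductLawLattice` (p430117): for smooth real vector fields `v, w : T^d → ℝ^d` on the unit
torus `T^d = (ℝ/ℤ)^d` the Fourier coefficients of the convective derivative `(v·∇)w` are CONVECTIVELY
DOMINATED by those of `v` and `w`,

  `‖𝓕((v·∇)w)(k)‖ ≤ 2π ∑_l ‖𝓕v(k - l)‖ · ⟨l⟩ · ‖𝓕w(l)‖`      (`enorm_mFourierCoeff_convect_le`)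

(`(v·∇)w = ∑ⱼ vⱼ ∂ⱼw`; the product rule `𝓕(χ • g) = 𝓕χ ⋆ 𝓕g` of `Torus.IsSmooth.mFourierCoeff_smul_eq_conv_scal`;
`𝓕(∂ⱼ g)(l) = 2πi lⱼ 𝓕g(l)`; Cauchy–Schwarz in the index `j`: `∑ⱼ |𝓕vⱼ| |lⱼ| ≤ ‖𝓕v‖ |l| ≤ ‖𝓕v‖ ⟨l⟩`),
whence, by `ConvectiveProductLawLattice.eNormSq_one_le_of_convective_domination`, the `H¹`-norm bound

  `‖(v·∇)w‖²_{H¹} ≤ 16π² σ² ‖v‖²_{H²} ‖w‖²_{H²}`,   `σ² = ∑_{l ∈ ℤ^d} ⟨l⟩⁻⁴`   (`eNormSq_one_convect_le`)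

in the tree's spectral Sobolev vocabulary (`Lattice.eNormSq s (mFourierCoeff (complexify ∘ ·))`,
`⟨l⟩ = (1+|l|²)^{1/2}`). This is the displayed constant `c_alg` of the R-β chain on the unit torus
(`HOME/instab/C-ALG-DISPLAY.md`; there on `(ℝ/2πℤ)³` with the `κ₀`-bracket, the same algebra).
No Leray projector here (it is a Fourier multiplier of norm `≤ 1` and only lowers the left side).
-/

noncomputable section

namespace Summit.NavierStokesRegularity.FluidComputer.ConvectiveProductLawTorus

open Literature.Analysis.FunctionSpaces Literature.Analysis.FunctionSpaces.Lattice
open Literature.Analysis.FunctionSpaces.Torus Literature.Analysis.FunctionSpaces.EuclideanSpace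
open Summit.NavierStokesRegularity.FluidComputer.ConvectiveProductLawLattice
open MeasureTheory UnitAddTorus
open scoped ENNReal NNReal

variable {d : Type*} [Fintype d] [DecidableEq d]
variable {v w : UnitAddTorus d → EuclideanSpace ℝ d}

/-- `complexify ((v·∇)w (x)) = ∑ⱼ (vⱼ x : ℂ) • complexify (∂ⱼ w x)` (`(v·∇)w = ∑ⱼ vⱼ ∂ⱼ w`). -/
theorem complexify_convect_eq_sum (hw : IsSmooth w) (x : UnitAddTorus d) :
    complexify (convect v w x) = ∑ j, ((v x j : ℝ) : ℂ) • complexify (partialDeriv j w x) := by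
  have hw1 : IsContDiff 1 w := hw.isContDiff (by simp)
  rw [convect, fderiv_apply_eq_sum_partialDeriv hw1 x (v x)]
  ext i
  simp only [complexify_apply, WithLp.ofLp_sum, Finset.sum_apply, WithLp.ofLp_smul, Pi.smul_apply,
    smul_eq_mul, Complex.ofReal_sum, Complex.ofReal_mul]

/-- **The product rule, convective form**: `𝓕((v·∇)w)(k) = ∑ⱼ (𝓕vⱼ ⋆ 𝓕(∂ⱼw))(k)` (lattice convolution
with the scalar symbol `𝓕vⱼ`, `Torus.IsSmooth.mFourierCoeff_smul_eq_conv_scal`). -/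
theorem mFourierCoeff_convect_eq_sum_conv (hv : IsSmooth v) (hw : IsSmooth w) (k : d → ℤ) :
    mFourierCoeff (complexify ∘ convect v w) k =
      ∑ j, conv (scal (mFourierCoeff (fun x => ((v x j : ℝ) : ℂ))))
        (mFourierCoeff (complexify ∘ partialDeriv j w)) k := by
  have h1 : (complexify ∘ convect v w) =
      fun x => ∑ j, (fun y => ((v y j : ℝ) : ℂ) • (complexify ∘ partialDeriv j w) y) x := by
    funext x
    simp only [Function.comp_apply]
    exact complexify_convect_eq_sum hw x
  rw [h1]
  refine (mFourierCoeff_finset_sum Finset.univ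
    (f := fun j y => ((v y j : ℝ) : ℂ) • (complexify ∘ partialDeriv j w) y) (fun j _ => ?_) k).trans ?_
  · exact (((hv.apply j).ofReal.continuous).smul
      ((hw.partialDeriv j).complexify_comp.continuous)).integrable_unitAddTorus
  · refine Finset.sum_congr rfl fun j _ => ?_
    exact congrFun ((hv.apply j).ofReal.mFourierCoeff_smul_eq_conv_scal ((hw.partialDeriv j).complexify_comp)) k

omit [DecidableEq d] in
/-- Discrete Cauchy–Schwarz in the index: `∑ⱼ ‖V j‖ |lⱼ| ≤ ‖V‖ ⟨l⟩` for `V ∈ ℂ^d`, `l ∈ ℤ^d`. -/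
theorem sum_norm_apply_mul_abs_le (V : EuclideanSpace ℂ d) (l : d → ℤ) :
    ∑ j, ‖V j‖ * |(l j : ℝ)| ≤ ‖V‖ * sobolevWeight 1 l := by
  have h := sum_mul_le_sqrt_mul_sqrt (fun j => ‖V j‖) (fun j => |(l j : ℝ)|)
  have hV : Real.sqrt (∑ j, ‖V j‖ ^ 2) = ‖V‖ := (EuclideanSpace.norm_eq V).symm
  have hl : Real.sqrt (∑ j, |(l j : ℝ)| ^ 2) ≤ sobolevWeight 1 l := by
    rw [sobolevWeight_one_eq_sqrt]
    refine Real.sqrt_le_sqrt ?_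
    simp only [sq_abs, freqNormSq]
    linarith
  calc ∑ j, ‖V j‖ * |(l j : ℝ)| ≤ Real.sqrt (∑ j, ‖V j‖ ^ 2) * Real.sqrt (∑ j, |(l j : ℝ)| ^ 2) := h
    _ ≤ ‖V‖ * sobolevWeight 1 l := by
        rw [hV]; exact mul_le_mul_of_nonneg_left hl (norm_nonneg _)

/-- Termwise bound of the `j`-sum of the convolution summands at a fixed frequency `l`:
`∑ⱼ ‖𝓕vⱼ(k-l)‖ ‖𝓕(∂ⱼw)(l)‖ ≤ 2π ‖𝓕v(k-l)‖ ⟨l⟩ ‖𝓕w(l)‖`. -/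
theorem sum_norm_coeff_mul_le (hv : IsSmooth v) (hw : IsSmooth w) (k l : d → ℤ) :
    ∑ j, ‖mFourierCoeff (fun x => ((v x j : ℝ) : ℂ)) (k - l)‖ *
        ‖mFourierCoeff (complexify ∘ partialDeriv j w) l‖ ≤
      2 * Real.pi * (‖mFourierCoeff (complexify ∘ v) (k - l)‖ *
        (sobolevWeight 1 l * ‖mFourierCoeff (complexify ∘ w) l‖)) := by
  have hvi : Integrable v volume := hv.continuous.integrable_unitAddTorus
  have hterm : ∀ j, ‖mFourierCoeff (fun x => ((v x j : ℝ) : ℂ)) (k - l)‖ *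
      ‖mFourierCoeff (complexify ∘ partialDeriv j w) l‖ =
      2 * Real.pi * (‖mFourierCoeff (complexify ∘ v) (k - l) j‖ * |(l j : ℝ)|) *
        ‖mFourierCoeff (complexify ∘ w) l‖ := by
    intro j
    have hc : mFourierCoeff (fun x => ((v x j : ℝ) : ℂ)) (k - l) = mFourierCoeff (complexify ∘ v) (k - l) j :=
      (mFourierCoeff_complexify_apply hvi (k - l) j).symm
    have hd : (complexify ∘ partialDeriv j w) = partialDeriv j (complexify ∘ w) := by
      funext x; exact (partialDeriv_complexify_comp hw j x).symm
    rw [hc, hd, mFourierCoeff_partialDeriv hw.complexify_comp j l, norm_smul]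
    have hn : ‖(2 * Real.pi * Complex.I * (l j : ℂ) : ℂ)‖ = 2 * Real.pi * |(l j : ℝ)| := by
      rw [show (2 * Real.pi * Complex.I * (l j : ℂ) : ℂ) = ((2 * Real.pi * (l j : ℝ) : ℝ) : ℂ) * Complex.I by
        push_cast; ring]
      rw [norm_mul, Complex.norm_I, mul_one, Complex.norm_real, Real.norm_eq_abs, abs_mul,
        abs_of_pos Real.two_pi_pos]
    rw [hn]; ring
  simp_rw [hterm]
  rw [← Finset.sum_mul, ← Finset.mul_sum]
  have hcs := sum_norm_apply_mul_abs_le (mFourierCoeff (complexify ∘ v) (k - l)) l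
  have h2pi : 0 ≤ 2 * Real.pi := Real.two_pi_pos.le
  calc 2 * Real.pi * (∑ j, ‖mFourierCoeff (complexify ∘ v) (k - l) j‖ * |(l j : ℝ)|) *
        ‖mFourierCoeff (complexify ∘ w) l‖
      ≤ 2 * Real.pi * (‖mFourierCoeff (complexify ∘ v) (k - l)‖ * sobolevWeight 1 l) *
        ‖mFourierCoeff (complexify ∘ w) l‖ := by gcongr
    _ = _ := by ring

/-- **Convective domination on the torus**: `‖𝓕((v·∇)w)(k)‖ ≤ 2π ∑_l ‖𝓕v(k-l)‖ ⟨l⟩ ‖𝓕w(l)‖`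
(`ℝ≥0∞` form, unconditional sum). -/
theorem enorm_mFourierCoeff_convect_le (hv : IsSmooth v) (hw : IsSmooth w) (k : d → ℤ) :
    ‖mFourierCoeff (complexify ∘ convect v w) k‖ₑ ≤
      ENNReal.ofReal (2 * Real.pi) * ∑' l, ‖mFourierCoeff (complexify ∘ v) (k - l)‖ₑ *
        (ENNReal.ofReal (sobolevWeight 1 l) * ‖mFourierCoeff (complexify ∘ w) l‖ₑ) := by
  rw [mFourierCoeff_convect_eq_sum_conv hv hw k]
  -- `‖∑ⱼ (aⱼ ⋆ cⱼ)(k)‖ ≤ ∑ⱼ ∑_l ‖aⱼ(k-l)‖ ‖cⱼ(l)‖`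
  have hscal : ∀ (χ : (d → ℤ) → ℂ) (m : d → ℤ),
      ‖(scal χ : (d → ℤ) → (EuclideanSpace ℂ d →L[ℂ] EuclideanSpace ℂ d)) m‖ₑ ≤ ‖χ m‖ₑ := by
    intro χ m
    rw [scal_apply, ← ofReal_norm, ← ofReal_norm]
    refine ENNReal.ofReal_le_ofReal ?_
    calc ‖χ m • (1 : EuclideanSpace ℂ d →L[ℂ] EuclideanSpace ℂ d)‖
        ≤ ‖χ m‖ * ‖(1 : EuclideanSpace ℂ d →L[ℂ] EuclideanSpace ℂ d)‖ := (norm_smul _ _).le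
      _ ≤ ‖χ m‖ * 1 := by gcongr; exact ContinuousLinearMap.norm_id_le
      _ = ‖χ m‖ := mul_one _
  calc ‖∑ j, conv (scal (mFourierCoeff (fun x => ((v x j : ℝ) : ℂ))))
          (mFourierCoeff (complexify ∘ partialDeriv j w)) k‖ₑ
      ≤ ∑ j, ‖conv (scal (mFourierCoeff (fun x => ((v x j : ℝ) : ℂ))))
          (mFourierCoeff (complexify ∘ partialDeriv j w)) k‖ₑ := enorm_sum_le _ _
    _ ≤ ∑ j, ∑' l, ‖mFourierCoeff (fun x => ((v x j : ℝ) : ℂ)) (k - l)‖ₑ *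
          ‖mFourierCoeff (complexify ∘ partialDeriv j w) l‖ₑ := by
        refine Finset.sum_le_sum fun j _ => (enorm_conv_apply_le _ _ k).trans ?_
        exact ENNReal.tsum_le_tsum fun l => mul_le_mul_left (hscal _ (k - l)) _
    _ = ∑' l, ∑ j, ‖mFourierCoeff (fun x => ((v x j : ℝ) : ℂ)) (k - l)‖ₑ *
          ‖mFourierCoeff (complexify ∘ partialDeriv j w) l‖ₑ := (tsum_finsetSum_comm _ _).symm
    _ = ∑' l, ENNReal.ofReal (∑ j, ‖mFourierCoeff (fun x => ((v x j : ℝ) : ℂ)) (k - l)‖ *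
          ‖mFourierCoeff (complexify ∘ partialDeriv j w) l‖) := by
        refine tsum_congr fun l => ?_
        rw [ENNReal.ofReal_sum_of_nonneg (fun j _ => mul_nonneg (norm_nonneg _) (norm_nonneg _))]
        refine Finset.sum_congr rfl fun j _ => ?_
        rw [ENNReal.ofReal_mul (norm_nonneg _), ofReal_norm, ofReal_norm]
    _ ≤ ∑' l, ENNReal.ofReal (2 * Real.pi * (‖mFourierCoeff (complexify ∘ v) (k - l)‖ *
          (sobolevWeight 1 l * ‖mFourierCoeff (complexify ∘ w) l‖))) :=
        ENNReal.tsum_le_tsum fun l => ENNReal.ofReal_le_ofReal (sum_norm_coeff_mul_le hv hw k l)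
    _ = ENNReal.ofReal (2 * Real.pi) * ∑' l, ‖mFourierCoeff (complexify ∘ v) (k - l)‖ₑ *
          (ENNReal.ofReal (sobolevWeight 1 l) * ‖mFourierCoeff (complexify ∘ w) l‖ₑ) := by
        rw [← ENNReal.tsum_mul_left]
        refine tsum_congr fun l => ?_
        rw [ENNReal.ofReal_mul Real.two_pi_pos.le, ENNReal.ofReal_mul (norm_nonneg _),
          ENNReal.ofReal_mul (sobolevWeight_pos _ _).le, ofReal_norm, ofReal_norm]

/-- **The convective product law `H² · H² → H¹` on the unit torus, explicit constant**
(`c_alg = 2·(2πσ)` in unit-torus units; `C-ALG-DISPLAY.md`):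
`‖(v·∇)w‖²_{H¹} ≤ 16π² σ² ‖v‖²_{H²} ‖w‖²_{H²}`, `σ² = ∑_l ⟨l⟩⁻⁴`, all norms the spectral lattice
norms `Lattice.eNormSq s` of the Fourier coefficients of the complexified fields. -/
theorem eNormSq_one_convect_le (hv : IsSmooth v) (hw : IsSmooth w) :
    eNormSq 1 (mFourierCoeff (complexify ∘ convect v w)) ≤
      4 * (∑' l : d → ℤ, ENNReal.ofReal (sobolevWeight (-2) l ^ 2)) *
        (ENNReal.ofReal ((2 * Real.pi) ^ 2) * eNormSq 2 (mFourierCoeff (complexify ∘ v)) *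
          eNormSq 2 (mFourierCoeff (complexify ∘ w))) := by
  -- absorb `2π` into the coefficients of `v`
  set cv : (d → ℤ) → EuclideanSpace ℂ d := fun m => ((2 * Real.pi : ℝ) : ℂ) • mFourierCoeff (complexify ∘ v) m
    with hcv
  have hcv_norm : ∀ m, ‖cv m‖ₑ = ENNReal.ofReal (2 * Real.pi) * ‖mFourierCoeff (complexify ∘ v) m‖ₑ := by
    intro m
    rw [hcv, enorm_smul, ← ofReal_norm ((2 * Real.pi : ℝ) : ℂ), Complex.norm_real,
      Real.norm_eq_abs, abs_of_pos Real.two_pi_pos]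
  have hdom : ∀ k, ‖mFourierCoeff (complexify ∘ convect v w) k‖ₑ ≤
      ∑' l, ‖cv (k - l)‖ₑ * (ENNReal.ofReal (sobolevWeight 1 l) * ‖mFourierCoeff (complexify ∘ w) l‖ₑ) := by
    intro k
    refine (enorm_mFourierCoeff_convect_le hv hw k).trans (le_of_eq ?_)
    rw [← ENNReal.tsum_mul_left]
    exact tsum_congr fun l => by rw [hcv_norm, mul_assoc]
  have h := eNormSq_one_le_of_convective_domination cv (mFourierCoeff (complexify ∘ w))
    (mFourierCoeff (complexify ∘ convect v w)) hdom
  have hcv2 : eNormSq 2 cv = ENNReal.ofReal ((2 * Real.pi) ^ 2) * eNormSq 2 (mFourierCoeff (complexify ∘ v)) := by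
    rw [eNormSq, eNormSq, ← ENNReal.tsum_mul_left]
    refine tsum_congr fun m => ?_
    rw [hcv_norm, mul_pow, ← ENNReal.ofReal_pow Real.two_pi_pos.le]
    ring
  rw [hcv2] at h
  exact h

end Summit.NavierStokesRegularity.FluidComputer.ConvectiveProductLawTorus
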